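import Literature.AlgebraicGeometry.Resolution.WeightedCentreBottomEndgame
import Literature.AlgebraicGeometry.Resolution.WeightedCentreBottomPureTerm
import HarnessLib

/-!
# Weighted centres — THEOREM A⁺ for a bottom class of weight `1` (the engine's ND0)

Instrument for engine 1's `W(f)` TOY MODEL (cell `pub-rosobs`, LF-MODEL-eng1-g45 §6.2 THEOREM A⁺, case `r = 1`: "X itself is a graded `k[T]`-substitution with `T := σ` (wt `1 =
w(L₁)`) satisfying the hypotheses of L7 at `Y := L₁` … ⇒ (P) fails at `L₁` ✗ [= ND0]"), NOT a resolution theorem and NOT about the invariant of [AbramovichTemkinWlodarczyk2024].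

* `autSubst` — a `k[σ]`-automorphism fixing the constants, restricted to `k[ε]`, as a `k`-algebra substitution `k[ε] → k[ε][σ]`;
* `false_of_moves_bottom_one` — a graded `X₀ ≡ id (mod σ)` fixing `g` that moves a slot `z` of minimal weight `w z = 1` contradicts (P) at `z`
  (`exists_apply_CX_bottom`: the move is `cσ`; the endgame `false_of_slotPinned_bottom` with `ψ := autSubst X₀`, `T := σ`).

References: [Lang2002, Ch. IV §1, Ch. XIII §4]; [Matsumura1987, §27]; [AbramovichTemkinWlodarczyk2024, §5.1 (p. 1575), Lemma 5.2.10 (p. 1577), Thm. 5.3.1 (2)–(3) (p. 1578)].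
-/

namespace Literature.AlgebraicGeometry.Resolution.WeightedBlowup.BottomClimb

open Polynomial OrderFiltration LevelProjection Truncation

section Subst

variable {k : Type*} [CommRing k] {ι : Type*}

/-- A `k[σ]`-automorphism fixing the constants, restricted to `k[ε]`: the `k`-algebra substitution `a ↦ x(a)` (construction). [cite: Lang2002, Ch. IV §1] -/
noncomputable def autSubst (x : (MvPolynomial ι k)[X] ≃+* (MvPolynomial ι k)[X]) (hxc : ∀ c : k, x (C (MvPolynomial.C c)) = C (MvPolynomial.C c)) :
    MvPolynomial ι k →ₐ[k] (MvPolynomial ι k)[X] :=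
  { (x : (MvPolynomial ι k)[X] →+* (MvPolynomial ι k)[X]).comp (Polynomial.C : MvPolynomial ι k →+* (MvPolynomial ι k)[X]) with
    commutes' := fun c => by
      show x (C (algebraMap k (MvPolynomial ι k) c)) = algebraMap k (MvPolynomial ι k)[X] c
      rw [Polynomial.algebraMap_apply, MvPolynomial.algebraMap_eq, hxc] }

/-- `autSubst x a = x (C a)` (plumbing). [cite: Lang2002, Ch. IV §1] -/
@[simp] theorem autSubst_apply (x : (MvPolynomial ι k)[X] ≃+* (MvPolynomial ι k)[X]) (hxc : ∀ c : k, x (C (MvPolynomial.C c)) = C (MvPolynomial.C c))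
    (a : MvPolynomial ι k) : autSubst x hxc a = x (C a) := rfl

end Subst

section One

variable {k : Type*} [Field k] {ι : Type*} [Fintype ι] [DecidableEq ι] {w : ι → ℚ}

/-- **THEOREM A⁺ (bottom weight `1`) = ND0** — LF-MODEL-eng1-g45 §6.2, case `r = 1`: a graded `k[σ]`-automorphism `X₀ ≡ id (mod σ)` fixing the constants and `g` that MOVES a slot
`z` of minimal weight `w z = 1` contradicts (P) at `z`: the move is `cσ` with `c ≠ 0` (`exists_apply_CX_bottom`), and `X₀|_{k[ε]}` is a graded `k[T]`-substitution with `T := σ`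
of weight `1 = w z` (`[σ^n] X₀(ε_i)` weighs `w i − n`), `≡ id (mod σ)`, fixing `g` — the endgame `false_of_slotPinned_bottom` applies verbatim.  Instrument for engine 1's `W(f)` toy
model, NOT a resolution theorem. [cite: AbramovichTemkinWlodarczyk2024, §5.1 (p. 1575), Thm. 5.3.1 (2)–(3) (p. 1578); Lang2002, Ch. IV §1, Ch. XIII §4; Matsumura1987, §27 (p. 207)] -/
theorem false_of_moves_bottom_one (hw : ∀ i, 0 ≤ w i) {X₀ : (MvPolynomial ι k)[X] ≃+* (MvPolynomial ι k)[X]} (hg : X₀ ∈ graded w (1 : ℚ))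
    (hb : X₀ ∈ baseFixing) (h1 : X₀ ∈ level (X : (MvPolynomial ι k)[X]) 1) {g : MvPolynomial ι k} (hfix : X₀ (C g) = C g)
    {z : ι} (hmin : ∀ j, w z ≤ w j) (hwz : w z = 1) (hmove : X₀ (C (MvPolynomial.X z)) ≠ C (MvPolynomial.X z)) (hP : SlotPinned w z g) :
    False := by
  obtain ⟨c, hc⟩ := exists_apply_CX_bottom hw hg h1 hmin (r := 1) (by rw [hwz, Nat.cast_one]) one_pos
  have hc0 : c ≠ 0 := fun h0 => hmove (by rw [hc, h0, map_zero, map_zero, zero_mul, add_zero])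
  refine false_of_slotPinned_bottom hw (autSubst X₀ hb.2) hmin (by rw [hwz]; exact one_pos) (fun i => ?_) (fun i n => ?_) hc0
    (by rw [autSubst_apply, hc, pow_one]) (by rw [autSubst_apply, hfix]) hP
  · obtain ⟨t, ht⟩ := h1.2 (C (MvPolynomial.X i))
    rw [autSubst_apply, ht, pow_one, coeff_add, coeff_C_zero, coeff_X_mul_zero, add_zero]
  · rw [autSubst_apply, hwz, nsmul_eq_mul, mul_one]
    have h := hg.1.isTW_CX i n
    rwa [nsmul_eq_mul, mul_one] at h

end One

end Literature.AlgebraicGeometry.Resolution.WeightedBlowup.BottomClimb
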